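import Mathlib
import Summits.Ventures.PercRepro2.Defs
import Summits.Ventures.PercRepro2.Graph
import Summits.Ventures.PercRepro2.OneColourSwitch
import Summits.Ventures.PercRepro2.RegionHubSign
import Summits.Ventures.PercRepro2.SideSwitch
import Summits.Ventures.PercRepro2.M9NoPocketDefs
import Summits.Ventures.PercRepro2.M9Unreached
import Summits.Ventures.PercRepro2.M9PocketRSEdgeTransfer
import Summits.Ventures.PercRepro2.M9PocketRootOnlyTransfer
import Summits.Ventures.PercRepro2.M9PocketRootOnlyD
import Summits.Ventures.PercRepro2.M9PocketRootOnlyPTransfer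
import Summits.Ventures.PercRepro2.M9PocketRootOnlyPWorlds
import Summits.Ventures.PercRepro2.M9PocketRootOnlyPGlue
import Summits.Ventures.PercRepro2.M9PocketRootOnlyPLegal

/-!
# `{r, s, p}` separates `d` from `q` ⇒ `dSignSum ≤ 0` (blind cell PercRepro2, p3 g41,
2026-08-29; `proofs/P3-POCKETRK.md` §10⁵ (j): hubs at ONE mark)

Let `L ∋ d` be a vertex set with `p, q, r, s ∉ L`, closed under adjacency except through `r`,
`s` and `p` — `d`'s side of the cut `{r, s, p}`, which may touch the mark `p` (hubs `d ~_W p`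
allowed) but not `q`.  A colouring of `G` is a colouring of the edges off `F` (`F` = the edges
inside `L ∪ {r, s, p}`) glued with a colouring `τ` of `F`; by `M9PocketRootOnlyPLegal` the glued
colouring is `Sep ∧ DOne` iff the restriction is and `τ` is ADMISSIBLE («`p` not `F`-joined to
`r`, `s` in either colour, no vertex of `L` other than `d` in both worlds of the `F`-graph»),
`σ_pq` is that of the restriction and `r ~_Y s` is the disjunction of the two links
(`legal_glue_iff_p`, `sigma_pq_glue_eq_p`, `conn_rs_glue_iff_p`).  The sum over the admissible
`τ` of `σ_rs` is `κ · σ_rs` of the restriction (`sum_sigma_rs_glue_of_link`, for any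
flip-invariant admissibility with such a link decomposition), so
`dSignSum_G = κ · dSignSum_{G − F}` (`dSignSum_eq_mul_restrict_p`); `d` is isolated in `G − F`,
hence **`dSignSum_nonpos_of_separated_d_p`**: `dSignSum ≤ 0` — no other hypothesis.  The
symmetric statement with `q` in place of `p` follows by exchanging the names.  Own work;
std axioms.
-/

namespace Summit.Ventures.PercRepro2

namespace NoPocket

open Finset Classical OneColourSwitch SideSwitch

variable {V : Type*} {E : Type*} {ends : E → Sym2 V} {p q r s d : V} {L : Set V}

section Swap

/-- `Sep` is symmetric in the marks `p`, `q`. -/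
lemma sep2_comm_marks_p3 {ω : Config E} : sep2 ends p q r s ω ↔ sep2 ends q p r s ω := by
  unfold sep2 sepY
  tauto

/-- `σ_pq` is symmetric in its two marks. -/
lemma sigma_comm_marks_p3 {ω : Config E} : sigma ends ω p q = sigma ends ω q p := by
  unfold sigma
  rw [if_congr (show Conn ends ω p q ↔ Conn ends ω q p from ⟨conn_symm, conn_symm⟩) rfl rfl,
    if_congr (show Conn ends (OneColourSwitch.compl ω) p q ↔
      Conn ends (OneColourSwitch.compl ω) q p from ⟨conn_symm, conn_symm⟩) rfl rfl]

end Swap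

section Count

variable [Fintype E] [DecidableEq E]

/-- **The sum over the admissible `τ` of `σ_rs`, for any flip-invariant admissibility `A` whose
admissible `τ` satisfy the link decomposition**: `κ · σ_rs` of the restriction. -/
lemma sum_sigma_rs_glue_of_link
    (A : ({e // ¬ (e ∉ within ends (L ∪ {r, s, p} : Set V))} → Bool) → Prop)
    (hA : ∀ τ, A (OneColourSwitch.compl τ) ↔ A τ)
    (ω' : {e // e ∉ within ends (L ∪ {r, s, p} : Set V)} → Bool)
    (hlink : ∀ τ, A τ →
      (Conn ends ((Equiv.piEquivPiSubtypeProd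
          (fun e => e ∉ within ends (L ∪ {r, s, p} : Set V)) (fun _ => Bool)).symm (ω', τ)) r s ↔
        Conn (fun e : {e // e ∉ within ends (L ∪ {r, s, p} : Set V)} => ends e.1) ω' r s ∨
          Conn (fun e : {e // ¬ (e ∉ within ends (L ∪ {r, s, p} : Set V))} => ends e.1) τ r s) ∧
      (Conn ends (OneColourSwitch.compl ((Equiv.piEquivPiSubtypeProd
          (fun e => e ∉ within ends (L ∪ {r, s, p} : Set V)) (fun _ => Bool)).symm (ω', τ))) r s ↔
        Conn (fun e : {e // e ∉ within ends (L ∪ {r, s, p} : Set V)} => ends e.1)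
            (OneColourSwitch.compl ω') r s ∨
          Conn (fun e : {e // ¬ (e ∉ within ends (L ∪ {r, s, p} : Set V))} => ends e.1)
            (OneColourSwitch.compl τ) r s)) :
    (∑ τ : ({e // ¬ (e ∉ within ends (L ∪ {r, s, p} : Set V))} → Bool),
      if A τ then sigma ends ((Equiv.piEquivPiSubtypeProd
        (fun e => e ∉ within ends (L ∪ {r, s, p} : Set V)) (fun _ => Bool)).symm (ω', τ)) r s
      else 0) =
    (∑ τ : ({e // ¬ (e ∉ within ends (L ∪ {r, s, p} : Set V))} → Bool),
      if A τ ∧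
        ¬ Conn (fun e : {e // ¬ (e ∉ within ends (L ∪ {r, s, p} : Set V))} => ends e.1) τ r s then
        (1 : ℤ) else 0) *
    sigma (fun e : {e // e ∉ within ends (L ∪ {r, s, p} : Set V)} => ends e.1) ω' r s := by
  have h1 : ∀ τ : ({e // ¬ (e ∉ within ends (L ∪ {r, s, p} : Set V))} → Bool),
      (if A τ then sigma ends ((Equiv.piEquivPiSubtypeProd
        (fun e => e ∉ within ends (L ∪ {r, s, p} : Set V)) (fun _ => Bool)).symm (ω', τ)) r s
      else 0) =
      (if A τ ∧
        (Conn (fun e : {e // e ∉ within ends (L ∪ {r, s, p} : Set V)} => ends e.1) ω' r s ∨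
          Conn (fun e : {e // ¬ (e ∉ within ends (L ∪ {r, s, p} : Set V))} => ends e.1) τ r s)
      then (1 : ℤ) else 0) -
      (if A τ ∧
        (Conn (fun e : {e // e ∉ within ends (L ∪ {r, s, p} : Set V)} => ends e.1)
            (OneColourSwitch.compl ω') r s ∨
          Conn (fun e : {e // ¬ (e ∉ within ends (L ∪ {r, s, p} : Set V))} => ends e.1)
            (OneColourSwitch.compl τ) r s) then (1 : ℤ) else 0) := by
    intro τ
    by_cases hAτ : A τ
    · obtain ⟨hY', hW'⟩ := hlink τ hAτ
      unfold sigma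
      rw [if_pos hAτ, if_congr hY' rfl rfl, if_congr hW' rfl rfl]
      by_cases hY : Conn (fun e : {e // e ∉ within ends (L ∪ {r, s, p} : Set V)} => ends e.1)
          ω' r s ∨
        Conn (fun e : {e // ¬ (e ∉ within ends (L ∪ {r, s, p} : Set V))} => ends e.1) τ r s <;>
      by_cases hW : Conn (fun e : {e // e ∉ within ends (L ∪ {r, s, p} : Set V)} => ends e.1)
          (OneColourSwitch.compl ω') r s ∨
        Conn (fun e : {e // ¬ (e ∉ within ends (L ∪ {r, s, p} : Set V))} => ends e.1)
          (OneColourSwitch.compl τ) r s <;>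
      simp [hAτ, hY, hW]
    · simp [hAτ]
  have h2 : ∑ τ : ({e // ¬ (e ∉ within ends (L ∪ {r, s, p} : Set V))} → Bool),
      (if A τ ∧
        (Conn (fun e : {e // e ∉ within ends (L ∪ {r, s, p} : Set V)} => ends e.1)
            (OneColourSwitch.compl ω') r s ∨
          Conn (fun e : {e // ¬ (e ∉ within ends (L ∪ {r, s, p} : Set V))} => ends e.1)
            (OneColourSwitch.compl τ) r s) then (1 : ℤ) else 0) =
      ∑ τ : ({e // ¬ (e ∉ within ends (L ∪ {r, s, p} : Set V))} → Bool),
      (if A τ ∧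
        (Conn (fun e : {e // e ∉ within ends (L ∪ {r, s, p} : Set V)} => ends e.1)
            (OneColourSwitch.compl ω') r s ∨
          Conn (fun e : {e // ¬ (e ∉ within ends (L ∪ {r, s, p} : Set V))} => ends e.1) τ r s)
      then (1 : ℤ) else 0) := by
    rw [← Equiv.sum_comp (Function.Involutive.toPerm
      (OneColourSwitch.compl (E := {e // ¬ (e ∉ within ends (L ∪ {r, s, p} : Set V))}))
      OneColourSwitch.compl_compl)]
    refine Finset.sum_congr rfl fun τ _ => ?_
    simp only [Function.Involutive.coe_toPerm, OneColourSwitch.compl_compl]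
    exact if_congr (and_congr (hA τ) Iff.rfl) rfl rfl
  rw [Finset.sum_congr rfl fun τ _ => h1 τ, Finset.sum_sub_distrib, h2, ← Finset.sum_sub_distrib,
    Finset.sum_mul]
  refine Finset.sum_congr rfl fun τ _ => ?_
  unfold sigma
  by_cases hAτ : A τ <;>
  by_cases hF : Conn (fun e : {e // ¬ (e ∉ within ends (L ∪ {r, s, p} : Set V))} => ends e.1)
      τ r s <;>
  by_cases hY : Conn (fun e : {e // e ∉ within ends (L ∪ {r, s, p} : Set V)} => ends e.1)
      ω' r s <;>
  by_cases hW : Conn (fun e : {e // e ∉ within ends (L ∪ {r, s, p} : Set V)} => ends e.1)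
      (OneColourSwitch.compl ω') r s <;>
  simp [hAτ, hF, hY, hW]

end Count

section MainP

variable [Fintype V] [DecidableEq V] [Fintype E] [DecidableEq E]

/-- **The single-`d` sign sum of `G` is a non-negative multiple of the one of `G` with the edges
inside `L ∪ {r, s, p}` removed** (`κ` = the number of admissible colourings of those edges with
no `r`–`s` link through them). -/
theorem dSignSum_eq_mul_restrict_p
    (hL : ∀ e x y, ends e = s(x, y) → x ∈ L → y ∈ L ∨ y = r ∨ y = s ∨ y = p)
    (hp : p ∉ L) (hq : q ∉ L) (hr : r ∉ L) (hs : s ∉ L) :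
    dSignSum ends p q r s d =
    (∑ τ : ({e // ¬ (e ∉ within ends (L ∪ {r, s, p} : Set V))} → Bool),
      if ((¬ Conn (fun e : {e // ¬ (e ∉ within ends (L ∪ {r, s, p} : Set V))} => ends e.1) τ p r ∧
          ¬ Conn (fun e : {e // ¬ (e ∉ within ends (L ∪ {r, s, p} : Set V))} => ends e.1) τ p s ∧
          ¬ Conn (fun e : {e // ¬ (e ∉ within ends (L ∪ {r, s, p} : Set V))} => ends e.1)
            (OneColourSwitch.compl τ) p r ∧
          ¬ Conn (fun e : {e // ¬ (e ∉ within ends (L ∪ {r, s, p} : Set V))} => ends e.1)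
            (OneColourSwitch.compl τ) p s) ∧
        ∀ x ∈ L, x ≠ d →
          x ∈ K2 (fun e : {e // ¬ (e ∉ within ends (L ∪ {r, s, p} : Set V))} => ends e.1) r s τ →
          x ∉ M2 (fun e : {e // ¬ (e ∉ within ends (L ∪ {r, s, p} : Set V))} => ends e.1) r s τ) ∧
        ¬ Conn (fun e : {e // ¬ (e ∉ within ends (L ∪ {r, s, p} : Set V))} => ends e.1) τ r s then
        (1 : ℤ) else 0) *
    dSignSum (fun e : {e // e ∉ within ends (L ∪ {r, s, p} : Set V)} => ends e.1) p q r s d := by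
  unfold dSignSum
  rw [← (Equiv.piEquivPiSubtypeProd (fun e => e ∉ within ends (L ∪ {r, s, p} : Set V))
    (fun _ => Bool)).symm.sum_comp, Fintype.sum_prod_type, Finset.mul_sum]
  refine Finset.sum_congr rfl fun ω' _ => ?_
  by_cases h : sep2 (fun e : {e // e ∉ within ends (L ∪ {r, s, p} : Set V)} => ends e.1) p q r s
      ω' ∧ DOne (fun e : {e // e ∉ within ends (L ∪ {r, s, p} : Set V)} => ends e.1) r s d ω'
  · rw [if_pos h]
    have hstep : ∀ τ : ({e // ¬ (e ∉ within ends (L ∪ {r, s, p} : Set V))} → Bool),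
        (if sep2 ends p q r s ((Equiv.piEquivPiSubtypeProd
            (fun e => e ∉ within ends (L ∪ {r, s, p} : Set V)) (fun _ => Bool)).symm (ω', τ)) ∧
            DOne ends r s d ((Equiv.piEquivPiSubtypeProd
            (fun e => e ∉ within ends (L ∪ {r, s, p} : Set V)) (fun _ => Bool)).symm (ω', τ)) then
          sigma ends ((Equiv.piEquivPiSubtypeProd
            (fun e => e ∉ within ends (L ∪ {r, s, p} : Set V)) (fun _ => Bool)).symm (ω', τ)) p q *
          sigma ends ((Equiv.piEquivPiSubtypeProd
            (fun e => e ∉ within ends (L ∪ {r, s, p} : Set V)) (fun _ => Bool)).symm (ω', τ)) r s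
        else 0) =
        sigma (fun e : {e // e ∉ within ends (L ∪ {r, s, p} : Set V)} => ends e.1) ω' p q *
        (if ((¬ Conn (fun e : {e // ¬ (e ∉ within ends (L ∪ {r, s, p} : Set V))} => ends e.1)
              τ p r ∧
            ¬ Conn (fun e : {e // ¬ (e ∉ within ends (L ∪ {r, s, p} : Set V))} => ends e.1)
              τ p s ∧
            ¬ Conn (fun e : {e // ¬ (e ∉ within ends (L ∪ {r, s, p} : Set V))} => ends e.1)
              (OneColourSwitch.compl τ) p r ∧
            ¬ Conn (fun e : {e // ¬ (e ∉ within ends (L ∪ {r, s, p} : Set V))} => ends e.1)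
              (OneColourSwitch.compl τ) p s) ∧
          ∀ x ∈ L, x ≠ d →
            x ∈ K2 (fun e : {e // ¬ (e ∉ within ends (L ∪ {r, s, p} : Set V))} => ends e.1) r s
              τ →
            x ∉ M2 (fun e : {e // ¬ (e ∉ within ends (L ∪ {r, s, p} : Set V))} => ends e.1) r s
              τ) then
          sigma ends ((Equiv.piEquivPiSubtypeProd
            (fun e => e ∉ within ends (L ∪ {r, s, p} : Set V)) (fun _ => Bool)).symm (ω', τ)) r s
        else 0) := by
      intro τ
      by_cases hA : ((¬ Conn (fun e : {e // ¬ (e ∉ within ends (L ∪ {r, s, p} : Set V))} =>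
            ends e.1) τ p r ∧
          ¬ Conn (fun e : {e // ¬ (e ∉ within ends (L ∪ {r, s, p} : Set V))} => ends e.1) τ p s ∧
          ¬ Conn (fun e : {e // ¬ (e ∉ within ends (L ∪ {r, s, p} : Set V))} => ends e.1)
            (OneColourSwitch.compl τ) p r ∧
          ¬ Conn (fun e : {e // ¬ (e ∉ within ends (L ∪ {r, s, p} : Set V))} => ends e.1)
            (OneColourSwitch.compl τ) p s) ∧
        ∀ x ∈ L, x ≠ d →
          x ∈ K2 (fun e : {e // ¬ (e ∉ within ends (L ∪ {r, s, p} : Set V))} => ends e.1) r s τ →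
          x ∉ M2 (fun e : {e // ¬ (e ∉ within ends (L ∪ {r, s, p} : Set V))} => ends e.1) r s τ)
      · have hg := (legal_glue_iff_p hL hp hq hr hs ω' τ).2 ⟨h, hA⟩
        rw [if_pos hg, if_pos hA, sigma_pq_glue_eq_p hL hp hq ω' τ hg.1]
      · rw [if_neg (fun hg => hA ((legal_glue_iff_p hL hp hq hr hs ω' τ).1 hg).2), if_neg hA,
          mul_zero]
    have key := sum_sigma_rs_glue_of_link
      (fun τ : ({e // ¬ (e ∉ within ends (L ∪ {r, s, p} : Set V))} → Bool) =>
        ((¬ Conn (fun e : {e // ¬ (e ∉ within ends (L ∪ {r, s, p} : Set V))} => ends e.1) τ p r ∧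
          ¬ Conn (fun e : {e // ¬ (e ∉ within ends (L ∪ {r, s, p} : Set V))} => ends e.1) τ p s ∧
          ¬ Conn (fun e : {e // ¬ (e ∉ within ends (L ∪ {r, s, p} : Set V))} => ends e.1)
            (OneColourSwitch.compl τ) p r ∧
          ¬ Conn (fun e : {e // ¬ (e ∉ within ends (L ∪ {r, s, p} : Set V))} => ends e.1)
            (OneColourSwitch.compl τ) p s) ∧
        ∀ x ∈ L, x ≠ d →
          x ∈ K2 (fun e : {e // ¬ (e ∉ within ends (L ∪ {r, s, p} : Set V))} => ends e.1) r s τ →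
          x ∉ M2 (fun e : {e // ¬ (e ∉ within ends (L ∪ {r, s, p} : Set V))} => ends e.1) r s τ))
      (fun τ => admissible_compl_iff_p τ) ω'
      (fun τ hAτ => conn_rs_glue_iff_p hL hr hs ω' τ h.1 hAτ.1.1 hAτ.1.2.1 hAτ.1.2.2.1
        hAτ.1.2.2.2)
    rw [Finset.sum_congr rfl fun τ _ => hstep τ, ← Finset.mul_sum]
    calc sigma (fun e : {e // e ∉ within ends (L ∪ {r, s, p} : Set V)} => ends e.1) ω' p q *
          ∑ τ : ({e // ¬ (e ∉ within ends (L ∪ {r, s, p} : Set V))} → Bool),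
          (if ((¬ Conn (fun e : {e // ¬ (e ∉ within ends (L ∪ {r, s, p} : Set V))} => ends e.1)
                τ p r ∧
              ¬ Conn (fun e : {e // ¬ (e ∉ within ends (L ∪ {r, s, p} : Set V))} => ends e.1)
                τ p s ∧
              ¬ Conn (fun e : {e // ¬ (e ∉ within ends (L ∪ {r, s, p} : Set V))} => ends e.1)
                (OneColourSwitch.compl τ) p r ∧
              ¬ Conn (fun e : {e // ¬ (e ∉ within ends (L ∪ {r, s, p} : Set V))} => ends e.1)
                (OneColourSwitch.compl τ) p s) ∧
            ∀ x ∈ L, x ≠ d →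
              x ∈ K2 (fun e : {e // ¬ (e ∉ within ends (L ∪ {r, s, p} : Set V))} => ends e.1) r s
                τ →
              x ∉ M2 (fun e : {e // ¬ (e ∉ within ends (L ∪ {r, s, p} : Set V))} => ends e.1) r s
                τ) then
            sigma ends ((Equiv.piEquivPiSubtypeProd
              (fun e => e ∉ within ends (L ∪ {r, s, p} : Set V)) (fun _ => Bool)).symm (ω', τ)) r s
          else 0)
        = sigma (fun e : {e // e ∉ within ends (L ∪ {r, s, p} : Set V)} => ends e.1) ω' p q *
          ((∑ τ : ({e // ¬ (e ∉ within ends (L ∪ {r, s, p} : Set V))} → Bool),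
            if ((¬ Conn (fun e : {e // ¬ (e ∉ within ends (L ∪ {r, s, p} : Set V))} => ends e.1)
                  τ p r ∧
                ¬ Conn (fun e : {e // ¬ (e ∉ within ends (L ∪ {r, s, p} : Set V))} => ends e.1)
                  τ p s ∧
                ¬ Conn (fun e : {e // ¬ (e ∉ within ends (L ∪ {r, s, p} : Set V))} => ends e.1)
                  (OneColourSwitch.compl τ) p r ∧
                ¬ Conn (fun e : {e // ¬ (e ∉ within ends (L ∪ {r, s, p} : Set V))} => ends e.1)
                  (OneColourSwitch.compl τ) p s) ∧
              ∀ x ∈ L, x ≠ d →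
                x ∈ K2 (fun e : {e // ¬ (e ∉ within ends (L ∪ {r, s, p} : Set V))} => ends e.1)
                  r s τ →
                x ∉ M2 (fun e : {e // ¬ (e ∉ within ends (L ∪ {r, s, p} : Set V))} => ends e.1)
                  r s τ) ∧
              ¬ Conn (fun e : {e // ¬ (e ∉ within ends (L ∪ {r, s, p} : Set V))} => ends e.1)
                τ r s then (1 : ℤ) else 0) *
          sigma (fun e : {e // e ∉ within ends (L ∪ {r, s, p} : Set V)} => ends e.1) ω' r s) := by
          congr 1
          convert key
      _ = _ := by ring
  · rw [if_neg h, mul_zero]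
    refine Finset.sum_eq_zero fun τ _ => ?_
    rw [if_neg (fun hg => h ((legal_glue_iff_p hL hp hq hr hs ω' τ).1 hg).1)]

/-- **`{r, s, p}` separates `d` from `q` ⇒ `dSignSum ≤ 0`**: for a vertex set `L ∋ d` with
`p, q, r, s ∉ L` closed under adjacency except through `r`, `s` and `p`, the single-`d` sign sum
is non-positive — hubs at `p` (`d ~_W p`), linking free blocks, pockets, `T`-edges and the
structure outside `L` all arbitrary. -/
theorem dSignSum_nonpos_of_separated_d_p
    (hL : ∀ e x y, ends e = s(x, y) → x ∈ L → y ∈ L ∨ y = r ∨ y = s ∨ y = p)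
    (hp : p ∉ L) (hq : q ∉ L) (hr : r ∉ L) (hs : s ∉ L) (hd : d ∈ L) :
    dSignSum ends p q r s d ≤ 0 := by
  have hdr : d ≠ r := fun h => hr (h ▸ hd)
  have hds : d ≠ s := fun h => hs (h ▸ hd)
  rw [dSignSum_eq_mul_restrict_p hL hp hq hr hs]
  refine mul_nonpos_iff.2 (Or.inl ⟨Finset.sum_nonneg fun τ _ => by split_ifs <;> norm_num, ?_⟩)
  -- in `G − F` the vertex `d` is isolated: every edge at `d` lies inside `L ∪ {r, s, p}`
  have hiso : ∀ e : {e // e ∉ within ends (L ∪ {r, s, p} : Set V)}, d ∉ ends e.1 := by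
    intro e he
    obtain ⟨y, hy⟩ := Sym2.mem_iff_exists.1 he
    exact e.2 (mem_within_of_mem_L_p hL hy hd)
  rw [dSignSum_eq_unreachedSum_of_isolated hiso hdr hds]
  exact unreachedSum_nonpos

omit [Fintype V] [DecidableEq V] in
/-- **The single-`d` sign sum is symmetric in the marks `p`, `q`.** -/
lemma dSignSum_comm_marks_p3 : dSignSum ends p q r s d = dSignSum ends q p r s d := by
  unfold dSignSum
  refine Finset.sum_congr rfl fun ω _ => ?_
  rw [if_congr (and_congr sep2_comm_marks_p3 Iff.rfl) rfl rfl, sigma_comm_marks_p3]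

/-- **`{r, s, q}` separates `d` from `p` ⇒ `dSignSum ≤ 0`** (the theorem with the marks
exchanged). -/
theorem dSignSum_nonpos_of_separated_d_q
    (hL : ∀ e x y, ends e = s(x, y) → x ∈ L → y ∈ L ∨ y = r ∨ y = s ∨ y = q)
    (hp : p ∉ L) (hq : q ∉ L) (hr : r ∉ L) (hs : s ∉ L) (hd : d ∈ L) :
    dSignSum ends p q r s d ≤ 0 := by
  rw [dSignSum_comm_marks_p3]
  exact dSignSum_nonpos_of_separated_d_p hL hq hp hr hs hd

end MainP

end NoPocket

end Summit.Ventures.PercRepro2
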